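import Summits.BirchSwinnertonDyer.BirchSwinnertonDyer.Theorems.ManinLocalTwoThreeTVRigidityAssembly
import Summits.BirchSwinnertonDyer.BirchSwinnertonDyer.Theorems.ManinLocalTwoThreePlusFunctional
import Summits.BirchSwinnertonDyer.BirchSwinnertonDyer.Theorems.ManinLocalTwoThreeUnitTwistOfLevelDifference
import Summits.BirchSwinnertonDyer.BirchSwinnertonDyer.Theorems.ManinLocalTwoThreeGamma1PlusVanishing
import Summits.BirchSwinnertonDyer.BirchSwinnertonDyer.Theorems.ManinLocalTwoThreeLevelLinearTelescope

/-!
# THE TOWER UNIT-TWIST LAW E-an-135 `KatoCurve.TowerUnitTwist p` IS A THEOREM for every prime `p` — hence `TowerExtension.RigidityImpliesTower`,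
# `TowerUnitTwistGeFive p`, E-an-135♭ `SomeTowerUnitTwist p`, and the es charter candidates E-es-66 / E-es-66₂ HOLD UNCONDITIONALLY, BY NAME
# (cell bsd-f2-manin, analytic lens MEMO-an §71–§72; prover seat bsd-line-manin23-p2 gen 11)

Summit `BirchSwinnertonDyer`, route `ManinLocalTwoThree`, cruxes C3 `ManinPrimeToThreeAtNine` (stmt-BirchSwinnertonDyer-22968, tower input
`h66`) / C2 `ManinOddAtFour` (stmt-…-22967, input `h66₂`).  The typer's obligation chain (`…/ManinAdditive/TowerExtension.lean`,
`…/TowerRigidity.lean`) for the TOWER INPUT of the two cruxes read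
`MultiHubRigidLaw ∧ MultiHubImpliesRigidity ⟹ TVPatternRigidityLaw p ⟹ (RigidityImpliesTower) TowerUnitTwistGeFive p ⟹ SomeTowerUnitTwist p
⟹ E-es-66 / E-es-66₂`; the first two rows were discharged by p2/p1 (`multiHubRigidLaw_holds`, `multiHubImpliesRigidity_holds`,
`tvPatternRigidityLaw_holds`).  THIS FILE DISCHARGES THE LAST ROW, the paper edge `RigidityImpliesTower` (MEMO-an §72.9: E-an-143
telescoping + E-an-140), by instantiating E-an-142's cell-free schema `TVPatternRigidity N q p` at the INTEGER PLUS FUNCTIONAL of the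
rational newform `f` of `W`:

* `g n r := F(r/qⁿ) mod p`, `F(x)·Ω⁺_f = ({∞,x}_f − {∞,0}_f) + conj` (`…PlusFunctional`: `exists_int_plusPart`, (P0) `plusFun_intCast`,
  (P1) `plusFun_add_intCast`, (EV) `plusFun_neg`, (HK) `plusFun_hecke` with `a = a_q(W) mod p`, (inv) `plusFun_gamma0` with the cocycle
  `c γ := Fc(γ) mod p`, `Fc(γ)·Ω⁺_f = {∞,γ∞}_f + conj`);
* (TV) from level `s+1 = max(n₁, 2, Wieferich level)` on: if NO primitive even `χ` of conductor `qⁿ`, `n ≥ n₁`, had `UnitTwistAt p W f χ`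
  (the negation of the tower law at `(W, f, q)`), every level-`n` difference has plus part `≡ 0 (mod p)`
  (`…UnitTwistOfLevelDifference.plus_dvd_of_forall_not_unitTwistAt` = level duality p671403 + LEMMA W + cyclotomic cofactors);
* E-an-142 (`hLaw N q`) ⟹ `g n r = κ'·n` on `q ∤ r`; E-an-143 (`…LevelLinearTelescope.levelLinear_telescope`: q-Farey path induction over
  E-an-140 `qFareyFibreConnected_holds` + LEMMA E + `κ'·ord_N(q) = 0` + the sign element) ⟹ `p ∣ Fc(γ)` on `{γ₁₁ ≡ 1 (N)}`;
* `…Gamma1PlusVanishing.false_of_gamma1_plusPart_dvd`: impossible under `PlusIndexPrimeTo p f`.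

Main declarations: `tvPattern_levelLinear_of_three_le` (E-an-142 for `q ≥ 3`, p1's assembly with the idle binder `5 ≤ q` relaxed),
**`exists_primitive_even_unitTwistAt`** (the tower theorem at every odd admissible `q`), **`rigidityImpliesTower_holds : RigidityImpliesTower`**,
**`towerUnitTwist_holds : p.Prime → KatoCurve.TowerUnitTwist p`** (E-an-135 BY NAME; `towerUnitTwist_three`, `towerUnitTwist_two`),
**`towerUnitTwistGeFive_holds`**, **`someTowerUnitTwist_holds : p.Prime → KatoCurve.SomeTowerUnitTwist p`** (E-an-135♭), and the es-lens charter candidates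
**`threeAdicWitnessOfPlusIndexPrimeToThree_holds : KatoCurve.ThreeAdicWitnessOfPlusIndexPrimeToThree`** (E-es-66) and
**`twoAdicWitnessOfPlusIndexOdd_holds : KatoCurve.TwoAdicWitnessOfPlusIndexOdd`** (E-es-66₂) — UNCONDITIONAL theorems of the tree
(no modularity hypothesis: they quantify over parametrisation data).

HONEST FRAMING: this closes the TOWER INPUT `h66` / `h66₂` of the C3 / C2 skeletons; the cruxes C2 `ManinOddAtFour`, C3 `ManinPrimeToThreeAtNine`,
Manin's conjecture and BSD are NOT proved by this file.  No definitions, no named facts, no sorry.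
-/

set_option linter.dupNamespace false
set_option autoImplicit false

noncomputable section

open scoped Classical MatrixGroups ModularForm ComplexConjugate

open CongruenceSubgroup Complex WeierstrassCurve Literature.NumberTheory.EllipticCurves
  Literature.NumberTheory.EllipticCurves.ModularForms
  Summit.BirchSwinnertonDyer.Rank1Residual.ManinAdditive.KatoCurve
  Summit.BirchSwinnertonDyer.Rank1Residual.ManinAdditive.TowerExtension

namespace Summit.BirchSwinnertonDyer.BirchSwinnertonDyer.Theorems.ManinLocalTwoThree

/-! ### E-an-142 at every odd prime `q` (the schema's binder `5 ≤ q` is idle: LEMMA MH needs only `3 ≤ q`) -/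

/-- **E-an-142 for `q ≥ 3`**: the conclusion of `TVPatternRigidity N q p` under `3 ≤ q` in place of `5 ≤ q` (same proof as p1's
`multiHubImpliesRigidity_holds`: `eq_zero_of_tv_zero` at `s = 0`; else `tv_resolution`, `fine_multiHub`, `tv_classIndep` with LEMMA MH
`multiHubRigidLaw_holds` (which is stated for `q ≥ 3`), `tv_conclusion_of_classIndep`). -/
theorem tvPattern_levelLinear_of_three_le {N q p : ℕ} (hp : p.Prime) (hq : q.Prime) (hq3 : 3 ≤ q) (hqpN : ¬ q ∣ p * N)
    (hadm : ¬ p ∣ (q - 1) / 2) (hN : 0 < N) (a κ : ZMod p) (s : ℕ) (g : ℕ → ℤ → ZMod p) (c : SL(2, ℤ) → ZMod p)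
    (level0 : ∀ r : ℤ, g 0 r = 0)
    (period : ∀ (n : ℕ) (r : ℤ), g n (r + (q : ℤ) ^ n) = g n r)
    (unreduce : ∀ (n : ℕ) (r : ℤ), g (n + 1) ((q : ℤ) * r) = g n r)
    (even : ∀ (n : ℕ) (r : ℤ), g n (-r) = g n r)
    (tv : ∀ (n : ℕ) (r : ℤ), s + 1 ≤ n → IsCoprime r (q : ℤ) → g n (r + (q : ℤ) ^ (n - 1)) = g n r)
    (kappa : κ = ∑ t ∈ Finset.range q, g 1 (t : ℤ))
    (hecke : ∀ (m : ℕ) (r : ℤ), ∑ t ∈ Finset.range q, g (m + 1) (r + (t : ℤ) * (q : ℤ) ^ m) = a * g m r - g (m - 1) r + κ)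
    (inv : ∀ γ : SL(2, ℤ), (N : ℤ) ∣ (γ : Matrix (Fin 2) (Fin 2) ℤ) 1 0 →
      ∀ (r : ℤ) (i j : ℕ) (ε : ℤˣ),
        (γ : Matrix (Fin 2) (Fin 2) ℤ) 1 0 * r + (γ : Matrix (Fin 2) (Fin 2) ℤ) 1 1 * (q : ℤ) ^ i = (ε : ℤ) * (q : ℤ) ^ j →
        g j ((ε : ℤ) * ((γ : Matrix (Fin 2) (Fin 2) ℤ) 0 0 * r + (γ : Matrix (Fin 2) (Fin 2) ℤ) 0 1 * (q : ℤ) ^ i)) - g i r = c γ) :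
    ∃ κ' : ZMod p, ∀ (n : ℕ) (r : ℤ), IsCoprime r (q : ℤ) → g n r = κ' * (n : ZMod p) := by
  have hqp : ¬ q ∣ p := fun h ↦ hqpN (dvd_mul_of_dvd_left h N)
  have hqN : Nat.Coprime q N := (Nat.Prime.coprime_iff_not_dvd hq).mpr fun h ↦ hqpN (dvd_mul_of_dvd_right h p)
  rcases Nat.eq_zero_or_pos s with rfl | hs
  · exact ⟨0, fun n r _ ↦ by rw [eq_zero_of_tv_zero g hq hqp a κ level0 period unreduce tv kappa hecke n r, zero_mul]⟩
  · have hqnep : q ≠ p := fun h ↦ hqp (h ▸ dvd_rfl)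
    have hMH : MultiHubRigid q p := multiHubRigidLaw_holds q p hq hp hq3 hqnep hadm
    have hres := tv_resolution g hq hqp a κ level0 period unreduce tv kappa hecke
    have hci := tv_classIndep hq hqN hs level0 period unreduce even hMH hres
      (TVRigidity.fine_multiHub level0 period even inv hres hq hqpN hN hs)
    exact TVRigidity.tv_conclusion_of_classIndep hq hqpN hN hs level0 period even inv hres hci

/-! ### Assembly -/

/-- **THE TOWER UNIT-TWIST THEOREM (E-an-135 at every odd admissible prime, every prime `p`)**: for the newform `f` of `W` with plus index
prime to `p`, an odd prime `q ≠ p`, `q ∤ N`, `p ∤ (q−1)/2`, and every `n₁`, some PRIMITIVE EVEN `χ` of conductor `qⁿ`, `n ≥ n₁`, has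
`UnitTwistAt p W f χ` (MEMO-an §72.9: instantiation of E-an-142's cell-free schema at the integer plus functional of `f`, (TV) from the negation
above the Wieferich level, E-an-142 for `q ≥ 3`, E-an-143 telescoping along q-Farey paths (E-an-140), contradiction with the plus index). -/
theorem exists_primitive_even_unitTwistAt {p : ℕ} (hp : p.Prime) (W : WeierstrassCurve ℚ) [W.IsElliptic] {N : ℕ} [NeZero N]
    (f : CuspForm (Gamma0 N) 2) (hWf : IsNewformOf W f) (hpi : PlusIndexPrimeTo p f)
    (q : ℕ) [Fact q.Prime] (hq3 : 3 ≤ q) (hqp : q ≠ p) (hqN : ¬ q ∣ N) (hpdiv : ¬ p ∣ (q - 1) / 2) (n₁ : ℕ) :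
    ∃ n : ℕ, n₁ ≤ n ∧ ∃ χ : DirichletCharacter ℂ (q ^ n), χ.IsPrimitive ∧ χ.Even ∧ UnitTwistAt p W f χ := by
  have hq : q.Prime := Fact.out
  have hq2 : q ≠ 2 := by omega
  have hf : IsNewform0 f := hWf.1
  have hQ : coeffField f = ⊥ := hWf.coeffField_eq_bot
  have hNpos : 0 < N := Nat.pos_of_ne_zero (NeZero.ne N)
  have hqNcop : q.Coprime N := (Nat.Prime.coprime_iff_not_dvd hq).mpr hqN
  have hqpN : ¬ q ∣ p * N := by
    intro h
    rcases (Nat.Prime.dvd_mul hq).mp h with h1 | h1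
    · exact hqp ((Nat.prime_dvd_prime_iff_eq hq hp).mp h1)
    · exact hqN h1
  by_contra hcon
  push Not at hcon
  -- the Wieferich level of the multiplicative primes and the starting level `s + 1`
  set nW : ℕ := (N.primeFactors.filter (fun ℓ ↦ ¬ ℓ ^ 2 ∣ N)).sup
    (fun ℓ ↦ padicValNat q ((ℓ ^ (p - 1)) ^ (q - 1) - 1)) + 1 with hnW
  set s : ℕ := max n₁ (max 2 nW) - 1 with hs
  have hs1 : s + 1 = max n₁ (max 2 nW) := by omega
  -- the plus functionals
  choose F hF using exists_int_plusPart (N := N) hf hQ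
  choose Fc hFc using exists_int_plusPart_cuspSymbol (N := N) hf hQ
  set g : ℕ → ℤ → ZMod p := fun n r ↦ ((F ((r : ℚ) / (q : ℚ) ^ n) : ℤ) : ZMod p) with hg
  set c : SL(2, ℤ) → ZMod p := fun γ ↦ ((Fc γ : ℤ) : ZMod p) with hc
  set a : ZMod p := ((W.LFunction q : ℤ) : ZMod p) with ha
  set κ : ZMod p := ∑ t ∈ Finset.range q, g 1 (t : ℤ) with hκ
  -- (P0)
  have hP0 : ∀ r : ℤ, g 0 r = 0 := by
    intro r
    simp only [hg, pow_zero, div_one]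
    rw [plusFun_intCast hf hQ F hF r, Int.cast_zero]
  -- (P1)
  have hP1 : ∀ (n : ℕ) (r : ℤ), g n (r + (q : ℤ) ^ n) = g n r := by
    intro n r
    simp only [hg]
    have hqn : ((q : ℚ) ^ n) ≠ 0 := pow_ne_zero _ (by exact_mod_cast hq.ne_zero)
    have e : (((r + (q : ℤ) ^ n : ℤ)) : ℚ) / (q : ℚ) ^ n = (r : ℚ) / (q : ℚ) ^ n + ((1 : ℤ) : ℚ) := by
      push_cast; field_simp
    rw [e, plusFun_add_intCast hf hQ F hF _ (coprime_den_intCast_div_primePow hq hqN r n) 1]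
  -- (P2)
  have hP2 : ∀ (n : ℕ) (r : ℤ), g (n + 1) ((q : ℤ) * r) = g n r := by
    intro n r
    simp only [hg]
    have hq0 : (q : ℚ) ≠ 0 := by exact_mod_cast hq.ne_zero
    have e : ((((q : ℤ) * r : ℤ)) : ℚ) / (q : ℚ) ^ (n + 1) = (r : ℚ) / (q : ℚ) ^ n := by
      push_cast; field_simp; ring
    rw [e]
  -- (EV)
  have hEV : ∀ (n : ℕ) (r : ℤ), g n (-r) = g n r := by
    intro n r
    simp only [hg]
    have e : (((-r : ℤ)) : ℚ) / (q : ℚ) ^ n = -((r : ℚ) / (q : ℚ) ^ n) := by push_cast; ring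
    rw [e, plusFun_neg hf hQ F hF _ (coprime_den_intCast_div_primePow hq hqN r n)]
  -- (TV) from level `s + 1` on
  have hTV : ∀ (n : ℕ) (r : ℤ), s + 1 ≤ n → IsCoprime r (q : ℤ) → g n (r + (q : ℤ) ^ (n - 1)) = g n r := by
    intro n r hn hr
    simp only [hg]
    have hn2 : 2 ≤ n := by omega
    have hnn₁ : n₁ ≤ n := by omega
    have hnWn : nW ≤ n := by omega
    have hb : ¬ (q : ℤ) ∣ r := by
      intro h
      have := Int.isCoprime_iff_gcd_eq_one.mp hr
      have h1 : (q : ℤ) ∣ 1 := by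
        have := hr; exact (IsCoprime.dvd_of_dvd_mul_left (this.symm) (dvd_mul_of_dvd_left h 1)) |> fun x => by simpa using x
      exact hq.one_lt.ne' (by exact_mod_cast Int.eq_one_of_dvd_one (by positivity) h1)
    have hnW' : ∀ ℓ ∈ N.primeFactors, ¬ ℓ ^ 2 ∣ N → padicValNat q ((ℓ ^ (p - 1)) ^ (q - 1) - 1) < n := by
      intro ℓ hℓ hℓ2
      have hℓS : ℓ ∈ N.primeFactors.filter (fun ℓ ↦ ¬ ℓ ^ 2 ∣ N) := Finset.mem_filter.mpr ⟨hℓ, hℓ2⟩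
      have h1 : padicValNat q ((ℓ ^ (p - 1)) ^ (q - 1) - 1) ≤
          (N.primeFactors.filter (fun ℓ ↦ ¬ ℓ ^ 2 ∣ N)).sup (fun ℓ ↦ padicValNat q ((ℓ ^ (p - 1)) ^ (q - 1) - 1)) :=
        Finset.le_sup (f := fun ℓ ↦ padicValNat q ((ℓ ^ (p - 1)) ^ (q - 1) - 1)) hℓS
      omega
    set x₁ : ℚ := (((r + 1 * (q : ℤ) ^ (n - 1) : ℤ)) : ℚ) / (q : ℚ) ^ n with hx₁
    set x₂ : ℚ := (r : ℚ) / (q : ℚ) ^ n with hx₂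
    have hx₁d : Nat.Coprime x₁.den N := coprime_den_intCast_div_primePow hq hqN _ n
    have hx₂d : Nat.Coprime x₂.den N := coprime_den_intCast_div_primePow hq hqN r n
    have hj : (modularSymbol f x₁ - modularSymbol f x₂) + conj (modularSymbol f x₁ - modularSymbol f x₂) =
        ((F x₁ - F x₂ : ℤ) : ℂ) * (plusPeriod f : ℂ) := by
      have e : modularSymbol f x₁ - modularSymbol f x₂ =
          (modularSymbol f x₁ - modularSymbol f 0) - (modularSymbol f x₂ - modularSymbol f 0) := by ring
      rw [e, map_sub, Int.cast_sub, sub_mul, ← hF x₁ hx₁d, ← hF x₂ hx₂d]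
      ring
    have hdvd := plus_dvd_of_forall_not_unitTwistAt hWf hp hq2 hqp hqN hpdiv hn2 hnW' (hcon n hnn₁) hb hj
    have e1 : (((r + (q : ℤ) ^ (n - 1) : ℤ)) : ℚ) / (q : ℚ) ^ n = x₁ := by rw [hx₁, one_mul]
    rw [e1]
    exact ((ZMod.intCast_eq_intCast_iff_dvd_sub _ _ _).mpr (by simpa using hdvd)).symm
  -- (HK)
  have hHK : ∀ (m : ℕ) (r : ℤ),
      ∑ t ∈ Finset.range q, g (m + 1) (r + (t : ℤ) * (q : ℤ) ^ m) = a * g m r - g (m - 1) r + κ := by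
    intro m r
    have h := plusFun_hecke hWf hq hqN F hF m r
    -- identify `F(q r / q^m)` with the value behind `g (m - 1) r`
    have hlow : F ((((q : ℤ) * r : ℤ) : ℚ) / (q : ℚ) ^ m) = F ((r : ℚ) / (q : ℚ) ^ (m - 1)) := by
      rcases m with _ | k
      · simp only [Nat.zero_sub, pow_zero, div_one]
        rw [plusFun_intCast hf hQ F hF, plusFun_intCast hf hQ F hF]
      · simp only [Nat.add_sub_cancel]
        congr 1
        have hq0 : (q : ℚ) ≠ 0 := by exact_mod_cast hq.ne_zero
        push_cast; field_simp; ring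
    rw [hlow] at h
    simp only [hg, hκ, ha]
    rw [← Int.cast_sum, h]
    push_cast
    ring
  -- (inv)
  have hINV : ∀ γ : SL(2, ℤ), (N : ℤ) ∣ (γ : Matrix (Fin 2) (Fin 2) ℤ) 1 0 →
      ∀ (r : ℤ) (i j : ℕ) (ε : ℤˣ),
        (γ : Matrix (Fin 2) (Fin 2) ℤ) 1 0 * r + (γ : Matrix (Fin 2) (Fin 2) ℤ) 1 1 * (q : ℤ) ^ i =
          (ε : ℤ) * (q : ℤ) ^ j →
        g j ((ε : ℤ) * ((γ : Matrix (Fin 2) (Fin 2) ℤ) 0 0 * r + (γ : Matrix (Fin 2) (Fin 2) ℤ) 0 1 * (q : ℤ) ^ i)) -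
          g i r = c γ := by
    intro γ hγN r i j ε hrow
    simp only [hg, hc]
    have hγ : γ ∈ Gamma0 N := by
      rw [Gamma0_mem]
      exact (ZMod.intCast_zmod_eq_zero_iff_dvd _ N).mpr hγN
    have hD : ((q : ℤ) ^ i) ≠ 0 := pow_ne_zero _ (by exact_mod_cast hq.ne_zero)
    have hDN : IsCoprime ((q : ℤ) ^ i) (N : ℤ) :=
      IsCoprime.pow_left (Nat.isCoprime_iff_coprime.mpr hqNcop)
    have hden : γ 1 0 * r + γ 1 1 * (q : ℤ) ^ i ≠ 0 := by
      rw [hrow]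
      exact mul_ne_zero (Units.ne_zero ε) (pow_ne_zero _ (by exact_mod_cast hq.ne_zero))
    have h6 := plusFun_gamma0 hf hQ F hF Fc hFc γ hγ r ((q : ℤ) ^ i) hD hDN hden
    have hqj : ((q : ℚ) ^ j) ≠ 0 := pow_ne_zero _ (by exact_mod_cast hq.ne_zero)
    have e1 : (((γ 0 0 * r + γ 0 1 * (q : ℤ) ^ i : ℤ)) : ℚ) / ((γ 1 0 * r + γ 1 1 * (q : ℤ) ^ i : ℤ) : ℚ) =
        ((((ε : ℤ) * (γ 0 0 * r + γ 0 1 * (q : ℤ) ^ i) : ℤ)) : ℚ) / (q : ℚ) ^ j := by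
      rw [hrow]
      rcases Int.units_eq_one_or ε with hε | hε
      · rw [hε]; push_cast; ring
      · rw [hε]; push_cast
        rw [neg_one_mul, neg_one_mul, div_neg, neg_div]
    have e2 : (((q : ℤ) ^ i : ℤ) : ℚ) = (q : ℚ) ^ i := by push_cast; ring
    rw [e1, e2] at h6
    rw [h6]
    push_cast
    ring
  -- E-an-142
  obtain ⟨κ', hκ'⟩ := tvPattern_levelLinear_of_three_le hp hq hq3 hqpN hpdiv hNpos a κ s g c hP0 hP1 hP2 hEV hTV rfl hHK hINV
  -- E-an-143: `c` vanishes on `Γ₁(N)`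
  have hc0 : ∀ γ : SL(2, ℤ), γ ∈ Gamma0 N → (N : ℤ) ∣ γ 1 1 - 1 → (γ 1 1 : ℤ) ≠ 0 → (p : ℤ) ∣ Fc γ := by
    intro γ hγ hγ1 hγne
    have hγN : (N : ℤ) ∣ γ 1 0 := by
      have := Gamma0_mem.mp hγ
      exact (ZMod.intCast_zmod_eq_zero_iff_dvd _ N).mp this
    have h := levelLinear_telescope (p := p) hq hqNcop (fun x ↦ ((F x : ℤ) : ZMod p)) c κ'
      (fun γ' hγ' B D hD hDN hden ↦ by
        have hγ'0 : γ' ∈ Gamma0 N := by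
          rw [Gamma0_mem]
          exact (ZMod.intCast_zmod_eq_zero_iff_dvd _ N).mpr hγ'
        have := plusFun_gamma0 hf hQ F hF Fc hFc γ' hγ'0 B D hD hDN hden
        simp only [hc, this]
        push_cast
        ring)
      (fun x hx ↦ by simp only [plusFun_neg hf hQ F hF x hx])
      (fun u ↦ by simp only [plusFun_intCast hf hQ F hF u, Int.cast_zero])
      (fun m u hu ↦ hκ' m u hu) γ hγN hγ1 hγne
    simp only [hc] at h
    exact (ZMod.intCast_zmod_eq_zero_iff_dvd _ _).mp h
  exact false_of_gamma1_plusPart_dvd hf hQ hpi Fc hFc hc0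

/-! ### Corollaries: `RigidityImpliesTower`, the tower laws E-an-135 / E-an-135♭ and the es charter candidates E-es-66 / E-es-66₂ BY NAME -/

/-- **`RigidityImpliesTower` HOLDS** (the last row of the typer's chain in `…/ManinAdditive/TowerExtension.lean`; its premise E-an-142 is itself
a theorem, `TVRigidity.tvPatternRigidityLaw_holds`, and is not even needed here). -/
theorem rigidityImpliesTower_holds : RigidityImpliesTower := by
  intro p hp _hLaw W _ N _ f hWf hpi q _ hq5 hqp hqN hpdiv n₁
  exact exists_primitive_even_unitTwistAt hp W f hWf hpi q (by omega) hqp hqN hpdiv n₁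

/-- **E-an-135 `KatoCurve.TowerUnitTwist p` HOLDS for every prime `p`** (the TOWER UNIT-TWIST LAW, an @[conjecture] node of
`…/ManinAdditive/TowerUnitTwist.lean`, BY NAME). -/
theorem towerUnitTwist_holds {p : ℕ} (hp : p.Prime) : TowerUnitTwist p := by
  intro W _ N _ f hWf hpi q _ hq2 hqp hqN hpdiv n₁
  have hq : q.Prime := Fact.out
  exact exists_primitive_even_unitTwistAt hp W f hWf hpi q (by have := hq.two_le; omega) hqp hqN hpdiv n₁

/-- E-an-135 at `p = 3` BY NAME. -/
theorem towerUnitTwist_three : TowerUnitTwist 3 := towerUnitTwist_holds Nat.prime_three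

/-- E-an-135 at `p = 2` BY NAME. -/
theorem towerUnitTwist_two : TowerUnitTwist 2 := towerUnitTwist_holds Nat.prime_two

/-- **`TowerUnitTwistGeFive p` HOLDS for every prime `p`** (typer edge `towerUnitTwistGeFive_of_towerUnitTwist`). -/
theorem towerUnitTwistGeFive_holds {p : ℕ} (hp : p.Prime) : TowerUnitTwistGeFive p :=
  towerUnitTwistGeFive_of_towerUnitTwist (towerUnitTwist_holds hp)

/-- **E-an-135♭ `KatoCurve.SomeTowerUnitTwist p` HOLDS for every prime `p`** (typer edge `someTowerUnitTwist_of_geFive`, Dirichlet). -/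
theorem someTowerUnitTwist_holds {p : ℕ} (hp : p.Prime) : SomeTowerUnitTwist p :=
  someTowerUnitTwist_of_geFive (towerUnitTwistGeFive_holds hp)

/-- **E-es-66 `KatoCurve.ThreeAdicWitnessOfPlusIndexPrimeToThree` HOLDS** (the es-lens charter candidate at `3`: for an optimal `W` with
`9 ∣ N` and plus index prime to `3`, a `3`-adic even polar UNIT witness exists) — unconditional, BY NAME, through E-an-136₃
`threeAdicWitness_of_towerUnitTwist` (TURNKEY-an-16: the C3 skeleton's tower input `h66`). -/
theorem threeAdicWitnessOfPlusIndexPrimeToThree_holds : ThreeAdicWitnessOfPlusIndexPrimeToThree :=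
  threeAdicWitness_of_towerUnitTwist towerUnitTwist_three

/-- **E-es-66₂ `KatoCurve.TwoAdicWitnessOfPlusIndexOdd` HOLDS** (the `p = 2` twin: optimal `W` with `4 ∣ N` and odd plus index) —
unconditional, BY NAME, through E-an-136₂ `twoAdicWitness_of_towerUnitTwist` (the C2 skeleton's tower input `h66₂`). -/
theorem twoAdicWitnessOfPlusIndexOdd_holds : TwoAdicWitnessOfPlusIndexOdd :=
  twoAdicWitness_of_towerUnitTwist towerUnitTwist_two

end Summit.BirchSwinnertonDyer.BirchSwinnertonDyer.Theorems.ManinLocalTwoThree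

end
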